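import Mathlib
import Summits.PneNP.PneNP.Statement
import Summits.PneNP.PneNP.Theorems.SoloBlindAnchor
import Literature.Computability.Complexity.SpaceProofs
import Literature.Computability.Complexity.TimeSpaceProofs
import Literature.Computability.Complexity.TimeSpaceChainProofs
import HarnessLib

/-!
# The floor of the summit: its weakest open consequences, kernel one-liners

Solo seat `solo-PneNP-blind` (blind mode), companion of §8♭ "THE FLOOR" of the seat's report
(`run/shared/lean/ideation/PneNP/solo-blind/paper/paper.md` v9). Any proof of the summit `PneNP`
proves, in passing, every statement below it in the chain `LOGSPACE ⊆ P ⊆ NP ⊆ PSPACE`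
separated from `SAT`; each of these consequences is itself OPEN in print (Arora–Barak 2009, §4.1:
"we cannot currently even rule out that 3SAT ∈ L"; "we do not know if P = PSPACE"), and the
space hierarchy theorem makes one of three adjacent separations true without saying which.
This file records the bookkeeping over the tree's proved inclusions
(`LOGSPACE_subset_P_holds`, `NP_subset_PSPACE_holds`, `LOGSPACE_ssubset_PSPACE_holds`) and the
seat's anchor `SoloBlind.pneNP_iff_SAT_not_mem_P`:

* `SoloBlind.SAT_not_mem_LOGSPACE_of_pneNP` — `PneNP → SAT ∉ LOGSPACE` (floor F1);
* `SoloBlind.LOGSPACE_ne_NP_of_pneNP` — `PneNP → LOGSPACE ≠ NP` (class form of F1);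
* `SoloBlind.P_ne_PSPACE_of_pneNP` — `PneNP → P ≠ PSPACE` (floor F3);
* `SoloBlind.floor_trichotomy` — unconditionally `LOGSPACE ≠ P ∨ PneNP ∨ NP ≠ PSPACE`
  (from `LOGSPACE ⊊ PSPACE`), with the contrapositive packaging
  `SoloBlind.pneNP_of_LOGSPACE_eq_P_of_NP_eq_PSPACE`: if both neighbouring inclusions
  collapse, the summit holds.

No new definitions. [cite: AroraBarakCC2009, Thm. 4.2, §4.1, Thm. 4.8]
[cite: StearnsHartmanisLewis1965]
-/

namespace Summit.PneNP.PneNP.Theorems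

open Literature.Computability.Complexity

/-- **Floor F1.** The summit implies `SAT ∉ LOGSPACE` — a statement open in print
(Arora–Barak 2009, §4.1: "we cannot currently even rule out that 3SAT ∈ L"), via `LOGSPACE ⊆ P`
(`LOGSPACE_subset_P_holds`) and the anchor `PneNP ↔ SAT ∉ P`.
[cite: AroraBarakCC2009, Thm. 4.2 and §4.1] -/
theorem SoloBlind.SAT_not_mem_LOGSPACE_of_pneNP (h : PneNP) : SAT ∉ LOGSPACE :=
  fun hS => (SoloBlind.pneNP_iff_SAT_not_mem_P.1 h) (LOGSPACE_subset_P_holds hS)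

/-- **Floor F1, class form.** The summit implies `LOGSPACE ≠ NP` (open in print, Arora–Barak
2009, §4.1: "it is open whether NP ≠ L"). [cite: AroraBarakCC2009, §4.1] -/
theorem SoloBlind.LOGSPACE_ne_NP_of_pneNP (h : PneNP) : LOGSPACE ≠ Nondeterministic.NP := by
  intro heq
  have hS : SAT ∈ LOGSPACE := by
    rw [heq]
    exact SAT_mem_NP_holds
  exact SoloBlind.SAT_not_mem_LOGSPACE_of_pneNP h hS

/-- **Floor F3.** The summit implies `P ≠ PSPACE` (open in print, Arora–Barak 2009, §4.1: "we do
not know if P = PSPACE … since NP ⊆ PSPACE, P = PSPACE implies P = NP"), via `NP ⊆ PSPACE`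
(`NP_subset_PSPACE_holds`). [cite: AroraBarakCC2009, §4.1] -/
theorem SoloBlind.P_ne_PSPACE_of_pneNP (h : PneNP) : Classes.P ≠ PSPACE := by
  intro heq
  apply SoloBlind.pneNP_iff_SAT_not_mem_P.1 h
  rw [heq]
  exact NP_subset_PSPACE_holds SAT_mem_NP_holds

/-- **The floor, bundled.** `PneNP → SAT ∉ LOGSPACE ∧ LOGSPACE ≠ NP ∧ P ≠ PSPACE`: three
consequences of the summit each of which is an open problem. [cite: AroraBarakCC2009, §4.1] -/
theorem SoloBlind.floor_of_pneNP (h : PneNP) :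
    SAT ∉ LOGSPACE ∧ LOGSPACE ≠ Nondeterministic.NP ∧ Classes.P ≠ PSPACE :=
  ⟨SoloBlind.SAT_not_mem_LOGSPACE_of_pneNP h, SoloBlind.LOGSPACE_ne_NP_of_pneNP h,
    SoloBlind.P_ne_PSPACE_of_pneNP h⟩

/-- **If both neighbouring inclusions collapse, the summit holds** — unconditionally, by the
space hierarchy theorem alone: `LOGSPACE = P` and `NP = PSPACE` together with `P = NP` would give
`PSPACE ⊆ LOGSPACE`, contradicting `LOGSPACE ⊊ PSPACE` (`LOGSPACE_ssubset_PSPACE_holds`).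
[cite: StearnsHartmanisLewis1965] [cite: AroraBarakCC2009, Thm. 4.8] -/
theorem SoloBlind.pneNP_of_LOGSPACE_eq_P_of_NP_eq_PSPACE (h1 : LOGSPACE = Classes.P)
    (h3 : Nondeterministic.NP = PSPACE) : PneNP := by
  rw [SoloBlind.pneNP_iff_P_ne_NP]
  intro hPNP
  have hsub : PSPACE ⊆ LOGSPACE := by
    rw [h1, hPNP, h3]
  have hss := LOGSPACE_ssubset_PSPACE_holds
  unfold LOGSPACE_ssubset_PSPACE at hss
  rw [Set.ssubset_def] at hss
  exact hss.2 hsub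

/-- **Unconditional trichotomy at the floor.** By the space hierarchy theorem
(`LOGSPACE ⊊ PSPACE`) at least one of the three adjacent separations `LOGSPACE ≠ P`, `P ≠ NP`
(the summit), `NP ≠ PSPACE` holds — and no known technique says which.
[cite: StearnsHartmanisLewis1965] [cite: AroraBarakCC2009, Thm. 4.8] -/
theorem SoloBlind.floor_trichotomy :
    LOGSPACE ≠ Classes.P ∨ PneNP ∨ Nondeterministic.NP ≠ PSPACE := by
  by_cases h1 : LOGSPACE = Classes.P
  · by_cases h3 : Nondeterministic.NP = PSPACE
    · exact Or.inr (Or.inl (SoloBlind.pneNP_of_LOGSPACE_eq_P_of_NP_eq_PSPACE h1 h3))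
    · exact Or.inr (Or.inr h3)
  · exact Or.inl h1

end Summit.PneNP.PneNP.Theorems
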